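import Summits.ValiantsHypothesis.ValiantsHypothesis.Theorems.SymPencilEquivariantSdcNotQPYoungDegreeBoundPrelim
import Summits.ValiantsHypothesis.ValiantsHypothesis.Theorems.SymPencilEquivariantSdcNotQPYoungFixedVectorOfDegreeBound
import HarnessLib

/-!
# ValiantsHypothesis / SymPencil — crux `EquivariantSdcNotQP` (stmt-ValiantsHypothesis-17792), line
# `birth_EquivariantSdcNotQP`, stub `stub_permify`: THE YOUNG-TABLEAUX DEGREE INEQUALITY (YD) PROVED,
# hence (H2) `YoungFixedVector` PROVED and the residue of `stub_permify` is (H1) alone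

`youngDegreeBound_holds` : **(YD)** `∀ λ ⊢ n, ∃ ν ∈ {λ, λᵗ}, [𝔖_n : R_ν] ≤ 2^{(log₂ f^λ + log₂ n + 8)^8}`
(hypothesis `hYD` of `youngFixedVector_of_degreeBound`, with `c = 8`).  Proof (helper of the item,
`--supports stmt-ValiantsHypothesis-17792 --as helper`; 0 definitions, 0 named facts; sub-shapes are built as
anonymous `Nat.Partition` terms inside the proofs): write `λ = (a, ν₀)` (`a = λ₁`, `FirstRowPeeling`);
* **long first row** `a ≥ 2(n−a)` (`index_le_of_long_row`): `[𝔖_n : R_λ] ≤ C(n,t)·t!` (`t = n − a`,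
  `index_rowStabilizer_mul_factorial_le`), `2^t ≤ C(n,t) ≤ 3 f^λ` (`two_pow_le_choose`,
  `choose_le_three_mul_numStandardTableaux`), so `t ≤ log₂ f + 2` and the index is `≤ 2^{(log₂ f + 3)^2}`;
  the same for `λᵗ` when its first row is long (`numStandardTableaux_transpose`);
* **both short** (`two_pow_le_of_short_row`): w.l.o.g. (transposing) `λ` has at most `a` rows, so
  `a ≥ √n`; with `q = ⌊√n⌋/4` either `λ` has `≥ q+1` rows and contains the hook `(a, 1^q)`, or it has
  `≤ q` rows and then `λ₂ ≥ q` and it contains the two-row shape `(a, q)`; by monotonicity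
  (`numStandardTableaux_mono`) and the long-first-row bound for the sub-shape, `2^q ≤ 3 f^λ`, whence
  `n! ≤ 2^{(log₂ f + log₂ n + 8)^8}`.
Consequences: `youngFixedVector_holds` = **(H2) verbatim, unconditionally**;
`permEmbeddingD_of_spinDichotomy : (H1) → (D)` (and, in the sibling file
`…PermifyOfSpinDichotomy.lean`, `permify_of_spinDichotomy : (H1) → ⟨stub_permify⟩`) — the registered residue (D) of `stub_permify` now rests on the single classical statement (H1) (spin
dichotomy: Schur multiplier `M(𝔄_n) = ℤ/2` and the degrees of the spin representations of `2·𝔄_n`;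
Schur 1911, Hoffman–Humphreys Thms. 2.11 and 10.7).

Honest framing: (H1), `stub_permify`, the crux `SymPencil.EquivariantSdcNotQP` and `VP ≠ VNP` remain
OPEN; nothing here is progress on `VP ≠ VNP`.
-/

noncomputable section

set_option linter.dupNamespace false

namespace Summit.ValiantsHypothesis.ValiantsHypothesis.Theorems.SymPencilEquivariantSdcNotQP.YoungBounds

open Literature.NumberTheory.DiophantineGeometry Matrix

/-! ### Long first row -/

/-- **Long first row.**  If `λ = (a, ν)` with `a ≥ 2(n − a)` then `[𝔖_n : R_λ] ≤ 2^{(log₂ f^λ + 3)^2}`.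
[folklore] -/
theorem index_le_of_long_row {n a : ℕ} (lam : Nat.Partition n) (ν : Nat.Partition (n - a))
    (hs : lam.sortedParts = a :: ν.sortedParts) (hlong : 2 * (n - a) ≤ a) :
    (rowStabilizer lam).index ≤ 2 ^ ((Nat.log 2 (numStandardTableaux lam) + 3) ^ 2) := by
  set t := n - a with ht
  set f := numStandardTableaux lam with hf
  have han : a + t = n := add_eq_of_sortedParts_eq_cons hs
  have h1 : (rowStabilizer lam).index * a.factorial ≤ n.factorial :=
    index_rowStabilizer_mul_factorial_le lam hs
  have h2 : n.factorial = n.choose t * t.factorial * a.factorial := by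
    rw [← han, ← Nat.add_choose_mul_factorial_mul_factorial a t]
    ring
  have hidx : (rowStabilizer lam).index ≤ n.choose t * t.factorial := by
    rw [h2] at h1
    exact Nat.le_of_mul_le_mul_right h1 (Nat.factorial_pos a)
  have h3 : n.choose t ≤ 3 * f := choose_le_three_mul_numStandardTableaux hs hlong
  have h4 : 2 ^ t ≤ n.choose t := two_pow_le_choose (by omega)
  set L := Nat.log 2 f with hL
  have hfL : f < 2 ^ (L + 1) := Nat.lt_pow_succ_log_self one_lt_two f
  have ht2 : t ≤ L + 2 := by
    have h5 : 2 ^ t < 2 ^ (L + 3) := by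
      calc 2 ^ t ≤ 3 * f := h4.trans h3
        _ < 4 * 2 ^ (L + 1) := by omega
        _ = 2 ^ (L + 3) := by ring
    have := (Nat.pow_lt_pow_iff_right (by norm_num : 1 < 2)).1 h5
    omega
  have h5 : t.factorial ≤ 2 ^ ((L + 2) ^ 2) := by
    calc t.factorial ≤ t ^ t := Nat.factorial_le_pow t
      _ ≤ (2 ^ t) ^ t := Nat.pow_le_pow_left Nat.lt_two_pow_self.le t
      _ = 2 ^ (t * t) := by rw [← pow_mul]
      _ ≤ 2 ^ ((L + 2) ^ 2) := Nat.pow_le_pow_right (by norm_num) (by nlinarith [ht2])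
  calc (rowStabilizer lam).index ≤ n.choose t * t.factorial := hidx
    _ ≤ 3 * f * 2 ^ ((L + 2) ^ 2) := Nat.mul_le_mul h3 h5
    _ ≤ 2 ^ (L + 3) * 2 ^ ((L + 2) ^ 2) := by
        refine Nat.mul_le_mul_right _ ?_
        calc 3 * f ≤ 4 * 2 ^ (L + 1) := by omega
          _ = 2 ^ (L + 3) := by ring
    _ = 2 ^ (L + 3 + (L + 2) ^ 2) := by rw [← pow_add]
    _ ≤ 2 ^ ((L + 3) ^ 2) := Nat.pow_le_pow_right (by norm_num) (by nlinarith)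

/-! ### Short first row and column: an exponential lower bound for `f^λ` -/

/-- The parts of `λ = (a, ν)` are all `≤ a`. [folklore] -/
theorem le_head_of_mem_sortedParts {n a : ℕ} (lam : Nat.Partition n) {l : List ℕ}
    (hs : lam.sortedParts = a :: l) {b : ℕ} (hb : b ∈ lam.sortedParts) : b ≤ a := by
  have hpw := lam.sortedGE_sortedParts.pairwise
  rw [hs] at hpw hb
  rcases List.mem_cons.1 hb with rfl | hb'
  · exact le_rfl
  · exact (List.pairwise_cons.1 hpw).1 b hb'

/-- **Short first row.**  If `λ = (a, ν)` with `a < 2(n − a)` and `λ` has at most `a` rows, then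
`2^{⌊√n⌋/4} ≤ 3 f^λ` (a hook `(a, 1^q)` or a two-row shape `(a, q)` sits inside `λ`). [folklore] -/
theorem two_pow_le_of_short_row {n a : ℕ} (lam : Nat.Partition n) (ν : Nat.Partition (n - a))
    (hs : lam.sortedParts = a :: ν.sortedParts) (hshort : a < 2 * (n - a))
    (hal : lam.sortedParts.length ≤ a) :
    2 ^ (Nat.sqrt n / 4) ≤ 3 * numStandardTableaux lam := by
  classical
  set q := Nat.sqrt n / 4 with hq
  have han : a + (n - a) = n := add_eq_of_sortedParts_eq_cons hs
  have hfpos : 1 ≤ numStandardTableaux lam := numStandardTableaux_pos_holds lam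
  -- `n ≤ a²`, so `√n ≤ a` and `2q ≤ a`
  have hn_le : n ≤ a * a := by
    have hsub : lam.youngDiagram.cells ⊆ (Finset.range lam.sortedParts.length) ×ˢ (Finset.range a) := by
      intro c hc
      rw [Finset.mem_product, Finset.mem_range, Finset.mem_range]
      rw [YoungDiagram.mem_cells, Nat.Partition.mem_youngDiagram_iff] at hc
      obtain ⟨h1, h2⟩ := hc
      exact ⟨h1, lt_of_lt_of_le h2 (le_head_of_mem_sortedParts lam hs (List.getElem_mem h1))⟩
    calc n = lam.youngDiagram.cells.card := lam.card_cells_youngDiagram.symm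
      _ ≤ ((Finset.range lam.sortedParts.length) ×ˢ (Finset.range a)).card := Finset.card_le_card hsub
      _ = lam.sortedParts.length * a := by rw [Finset.card_product, Finset.card_range, Finset.card_range]
      _ ≤ a * a := Nat.mul_le_mul_right _ hal
  have hsqrt : Nat.sqrt n ≤ a := by
    have := Nat.sqrt_le_sqrt hn_le
    rwa [Nat.sqrt_eq a] at this
  have h2q : 2 * q ≤ a := by omega
  rcases Nat.eq_zero_or_pos q with hq0 | hqpos
  · rw [hq0, pow_zero]; omega
  have ha : 0 < a := by omega
  -- the common final step, for a sub-shape `μ = (a, body) ⊢ a + q` inside `λ`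
  have finish : ∀ (μ : Nat.Partition (a + q)) (body : Nat.Partition q),
      μ.sortedParts = a :: body.sortedParts → μ.youngDiagram.cells ⊆ lam.youngDiagram.cells →
      2 ^ q ≤ 3 * numStandardTableaux lam := by
    intro μ body hμ hsubμ
    have hfμ : numStandardTableaux μ ≤ numStandardTableaux lam := numStandardTableaux_mono μ lam hsubμ
    have hchoose : (a + q).choose q ≤ 3 * numStandardTableaux μ :=
      choose_le_three_mul_numStandardTableaux hμ h2q
    have hpow : 2 ^ q ≤ (a + q).choose q := two_pow_le_choose (by omega)
    omega
  by_cases hrows : q ≤ ν.sortedParts.length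
  · -- the hook `(a, 1^q)`
    let body : Nat.Partition q :=
      ⟨Multiset.replicate q 1, fun hi => by rw [Multiset.eq_of_mem_replicate hi]; exact one_pos,
        by simp⟩
    have hbody : body.sortedParts = List.replicate q 1 := by
      rw [List.eq_replicate_iff]
      refine ⟨by rw [Nat.Partition.length_sortedParts]; simp [body], fun b hb => ?_⟩
      have hb' : b ∈ body.parts := (Multiset.mem_sort _).1 hb
      exact Multiset.eq_of_mem_replicate hb'
    let μ : Nat.Partition (a + q) :=
      ⟨a ::ₘ body.parts, fun hi => by
          rcases Multiset.mem_cons.1 hi with rfl | hi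
          · exact ha
          · exact body.parts_pos hi,
        by rw [Multiset.sum_cons, body.parts_sum]⟩
    have hμ : μ.sortedParts = a :: body.sortedParts :=
      sortedParts_eq_cons μ body rfl (fun b hb => by
        have : b = 1 := Multiset.eq_of_mem_replicate hb
        omega)
    refine finish μ body hμ ?_
    intro c hc
    rw [YoungDiagram.mem_cells, Nat.Partition.mem_youngDiagram_iff] at hc ⊢
    rw [hμ, hbody] at hc
    rw [hs]
    obtain ⟨i, j⟩ := c
    obtain ⟨h1, h2⟩ := hc
    cases i with
    | zero =>
      refine ⟨by simp, ?_⟩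
      simpa using h2
    | succ i =>
      have hi : i < q := by simpa using h1
      have hj : j < 1 := by simpa [List.getElem_cons_succ] using h2
      have hi' : i < ν.sortedParts.length := lt_of_lt_of_le hi hrows
      refine ⟨by rw [List.length_cons]; omega, ?_⟩
      have hpos : 0 < ν.sortedParts[i] := ν.pos_of_mem_sortedParts (List.getElem_mem hi')
      simp only [List.getElem_cons_succ]
      omega
  · -- the two-row shape `(a, q)`: here `λ₂ ≥ q`
    rw [not_le] at hrows
    -- the second row
    obtain ⟨b, l', hνs⟩ : ∃ b l', ν.sortedParts = b :: l' := by
      cases hν : ν.sortedParts with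
      | nil =>
        exfalso
        have hsum := ν.sum_sortedParts
        rw [hν, List.sum_nil] at hsum
        omega
      | cons b l' => exact ⟨b, l', rfl⟩
    have hle : ∀ x ∈ l', x ≤ b := fun x hx =>
      le_head_of_mem_sortedParts ν hνs (by rw [hνs]; exact List.mem_cons_of_mem _ hx)
    have hsum : n - a = b + l'.sum := by
      have := ν.sum_sortedParts
      rw [hνs, List.sum_cons] at this
      omega
    have hl' : l'.sum ≤ l'.length * b := by
      have := List.sum_le_card_nsmul l' b hle
      simpa using this
    have hlen : l'.length + 1 < q := by rw [hνs] at hrows; simpa using hrows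
    have hqb : q ≤ b := by
      by_contra hqb
      rw [not_le] at hqb
      have h16 : 16 * (q * q) ≤ n := by
        have := Nat.sqrt_le n
        have h4 : 4 * q ≤ Nat.sqrt n := by omega
        nlinarith
      have h3t : n < 3 * (n - a) := by omega
      have htq : n - a < q * q := by
        calc n - a = b + l'.sum := hsum
          _ ≤ b + l'.length * b := by omega
          _ = (l'.length + 1) * b := by ring
          _ < q * q := by
              calc (l'.length + 1) * b ≤ (l'.length + 1) * q := Nat.mul_le_mul_left _ hqb.le
                _ < q * q := Nat.mul_lt_mul_of_pos_right hlen hqpos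
      omega
    let body : Nat.Partition q := Nat.Partition.indiscrete q
    have hbodyp : body.parts = {q} := Nat.Partition.indiscrete_parts (by omega)
    have hbody : body.sortedParts = [q] := by
      change body.parts.sort (· ≥ ·) = [q]
      rw [hbodyp, Multiset.sort_singleton]
    let μ : Nat.Partition (a + q) :=
      ⟨a ::ₘ body.parts, fun hi => by
          rcases Multiset.mem_cons.1 hi with rfl | hi
          · exact ha
          · exact body.parts_pos hi,
        by rw [Multiset.sum_cons, body.parts_sum]⟩
    have hμ : μ.sortedParts = a :: body.sortedParts :=
      sortedParts_eq_cons μ body rfl (fun x hx => by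
        rw [hbodyp, Multiset.mem_singleton] at hx
        omega)
    refine finish μ body hμ ?_
    intro c hc
    rw [YoungDiagram.mem_cells, Nat.Partition.mem_youngDiagram_iff] at hc ⊢
    rw [hμ, hbody] at hc
    rw [hs, hνs]
    obtain ⟨i, j⟩ := c
    obtain ⟨h1, h2⟩ := hc
    cases i with
    | zero =>
      refine ⟨by simp, ?_⟩
      simpa using h2
    | succ i =>
      have hi : i = 0 := by simp at h1; omega
      subst hi
      have hj : j < q := by simpa using h2
      refine ⟨by simp, ?_⟩
      simp only [List.getElem_cons_succ, List.getElem_cons_zero]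
      omega

/-! ### The degree inequality (YD) -/

/-- Length of the sorted parts = number of rows = `colLen 0` of the diagram. [folklore] -/
theorem length_sortedParts_eq_colLen {n : ℕ} (μ : Nat.Partition n) :
    μ.sortedParts.length = μ.youngDiagram.colLen 0 := by
  rw [← μ.rowLens_youngDiagram, YoungDiagram.length_rowLens]

/-- For `μ = (a, …)`, `rowLen 0` of the diagram is `a`. [folklore] -/
theorem rowLen_zero_eq_head {n a : ℕ} (μ : Nat.Partition n) {l : List ℕ} (hs : μ.sortedParts = a :: l) :
    μ.youngDiagram.rowLen 0 = a := by
  have h := μ.rowLens_youngDiagram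
  rw [hs] at h
  have hlen : 0 < μ.youngDiagram.rowLens.length := by rw [h]; simp
  have h2 : μ.youngDiagram.rowLens[0] = μ.youngDiagram.rowLen 0 :=
    @YoungDiagram.get_rowLens μ.youngDiagram 0 hlen
  rw [← h2]
  simp [h]

/-- Quasi-polynomial absorption for the short case: `n·(log₂ n + 1) ≤ (L + log₂ n + 8)^8` once
`⌊√n⌋/4 ≤ L + 2`. [folklore] -/
theorem short_budget (n L : ℕ) (hq : Nat.sqrt n / 4 ≤ L + 2) :
    n * (Nat.log 2 n + 1) ≤ (L + Nat.log 2 n + 8) ^ 8 := by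
  set A := Nat.log 2 n with hA
  set s := Nat.sqrt n with hsn
  set x := L + A + 8 with hx
  have hn : n < (s + 1) * (s + 1) := Nat.lt_succ_sqrt n
  have hs1 : s + 1 ≤ 4 * x := by omega
  have hA1 : A + 1 ≤ x := by omega
  have h8 : 8 ≤ x := by omega
  calc n * (A + 1) ≤ (s + 1) * (s + 1) * x := Nat.mul_le_mul hn.le hA1
    _ ≤ (4 * x) * (4 * x) * x := Nat.mul_le_mul_right _ (Nat.mul_le_mul hs1 hs1)
    _ = 16 * x ^ 3 := by ring
    _ ≤ x ^ 5 * x ^ 3 := by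
        refine Nat.mul_le_mul_right _ ?_
        calc 16 ≤ 8 ^ 5 := by norm_num
          _ ≤ x ^ 5 := Nat.pow_le_pow_left h8 5
    _ = x ^ 8 := by ring

/-- **(YD), the Young-tableaux degree inequality, with `c = 8`.**  For every `λ ⊢ n`, one of `λ`, `λᵗ`
has a Young subgroup of index `≤ 2^{(log₂ f^λ + log₂ n + 8)^8}` — a quasi-polynomial form of the classical
fact that an irreducible `[λ]` of small degree has a long first row or column (Rasala 1977; James–Kerber
2.3.21). [folklore] -/
theorem youngDegreeBound_holds : ∃ c : ℕ, ∀ (n : ℕ) (lam : Nat.Partition n), ∃ ν : Nat.Partition n,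
      (ν = lam ∨ ν = lam.transpose) ∧
        (rowStabilizer ν).index ≤ 2 ^ ((Nat.log 2 (numStandardTableaux lam) + Nat.log 2 n + c) ^ c) := by
  refine ⟨8, fun n lam => ?_⟩
  set f := numStandardTableaux lam with hf
  set L := Nat.log 2 f with hL
  set A := Nat.log 2 n with hA
  have hbig : ∀ m : ℕ, m ≤ (L + 3) ^ 2 → m ≤ (L + A + 8) ^ 8 := by
    intro m hm
    refine hm.trans ?_
    calc (L + 3) ^ 2 ≤ (L + A + 8) ^ 2 := Nat.pow_le_pow_left (by omega) 2
      _ ≤ (L + A + 8) ^ 8 := Nat.pow_le_pow_right (by omega) (by norm_num)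
  rcases Nat.eq_zero_or_pos n with hn0 | hn
  · -- `n = 0`: the group is trivial
    subst hn0
    refine ⟨lam, Or.inl rfl, ?_⟩
    have h1 : (rowStabilizer lam).index ∣ 1 := by
      have := Subgroup.index_dvd_card (rowStabilizer lam)
      rwa [Nat.card_perm, Nat.card_eq_fintype_card, Fintype.card_fin, Nat.factorial_zero] at this
    rw [Nat.dvd_one.1 h1]
    exact Nat.one_le_two_pow
  obtain ⟨ν₀, hs⟩ := exists_sortedParts_eq_sup_cons lam (by omega)
  obtain ⟨ν₀', hs'⟩ := exists_sortedParts_eq_sup_cons lam.transpose (by omega)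
  have hf' : numStandardTableaux lam.transpose = f := numStandardTableaux_transpose lam
  have hlen1 : lam.transpose.sortedParts.length = lam.parts.sup := by
    rw [length_sortedParts_eq_colLen, Nat.Partition.youngDiagram_transpose, YoungDiagram.colLen_transpose,
      rowLen_zero_eq_head lam hs]
  have hlen2 : lam.sortedParts.length = lam.transpose.parts.sup := by
    rw [length_sortedParts_eq_colLen, ← YoungDiagram.rowLen_transpose, ← Nat.Partition.youngDiagram_transpose,
      rowLen_zero_eq_head lam.transpose hs']
  by_cases hA1 : 2 * (n - lam.parts.sup) ≤ lam.parts.sup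
  · exact ⟨lam, Or.inl rfl, (index_le_of_long_row lam ν₀ hs hA1).trans
      (Nat.pow_le_pow_right (by norm_num) (hbig _ le_rfl))⟩
  by_cases hA2 : 2 * (n - lam.transpose.parts.sup) ≤ lam.transpose.parts.sup
  · refine ⟨lam.transpose, Or.inr rfl, ?_⟩
    have h := index_le_of_long_row lam.transpose ν₀' hs' hA2
    rw [hf'] at h
    exact h.trans (Nat.pow_le_pow_right (by norm_num) (hbig _ le_rfl))
  -- both short: `2^q ≤ 3 f`
  have hB : 2 ^ (Nat.sqrt n / 4) ≤ 3 * f := by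
    by_cases hal : lam.sortedParts.length ≤ lam.parts.sup
    · exact two_pow_le_of_short_row lam ν₀ hs (by omega) hal
    · have h := two_pow_le_of_short_row lam.transpose ν₀' hs' (by omega) (by rw [hlen1]; omega)
      rwa [hf'] at h
  refine ⟨lam, Or.inl rfl, ?_⟩
  have hfL : f < 2 ^ (L + 1) := Nat.lt_pow_succ_log_self one_lt_two f
  have hq : Nat.sqrt n / 4 ≤ L + 2 := by
    have h5 : 2 ^ (Nat.sqrt n / 4) < 2 ^ (L + 3) := by
      calc 2 ^ (Nat.sqrt n / 4) ≤ 3 * f := hB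
        _ < 4 * 2 ^ (L + 1) := by omega
        _ = 2 ^ (L + 3) := by ring
    have := (Nat.pow_lt_pow_iff_right (by norm_num : 1 < 2)).1 h5
    omega
  have hnA : n ≤ 2 ^ (A + 1) := (Nat.lt_pow_succ_log_self one_lt_two n).le
  calc (rowStabilizer lam).index ≤ n.factorial := by
        have h := Subgroup.index_dvd_card (rowStabilizer lam)
        rw [Nat.card_perm, Nat.card_eq_fintype_card, Fintype.card_fin] at h
        exact Nat.le_of_dvd (Nat.factorial_pos n) h
    _ ≤ n ^ n := Nat.factorial_le_pow n
    _ ≤ (2 ^ (A + 1)) ^ n := Nat.pow_le_pow_left hnA n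
    _ = 2 ^ (n * (A + 1)) := by rw [← pow_mul, mul_comm]
    _ ≤ 2 ^ ((L + A + 8) ^ 8) := Nat.pow_le_pow_right (by norm_num) (short_budget n L hq)

/-! ### (H2) and the reduction of `stub_permify` to (H1) -/

/-- **(H2) `YoungFixedVector` — PROVED.**  Every complex representation of `𝔄_n × 𝔄_n` of dimension
`k ≥ 1` has a nonzero linear functional fixed by a subgroup of index `≤ 2^{(log₂ k + log₂ n + c)^c}`
(hypothesis `hYoung` of `permEmbeddingD_of_alternatingBounds`, verbatim): Young's rule, completeness of
the Specht modules and the degree inequality (YD). [folklore] -/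
theorem youngFixedVector_holds : ∃ c : ℕ, ∀ (n k : ℕ)
      (σ : ↥(alternatingGroup (Fin n)) × ↥(alternatingGroup (Fin n)) →* GL (Fin k) ℂ), 1 ≤ k →
      ∃ Y : Subgroup (↥(alternatingGroup (Fin n)) × ↥(alternatingGroup (Fin n))),
        Y.index ≤ 2 ^ ((Nat.log 2 k + Nat.log 2 n + c) ^ c) ∧
        ∃ ℓ : (Fin k → ℂ) →ₗ[ℂ] ℂ, ℓ ≠ 0 ∧
          ∀ y ∈ Y, ℓ ∘ₗ Matrix.toLin' (σ y : Matrix (Fin k) (Fin k) ℂ) = ℓ :=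
  youngFixedVector_of_degreeBound youngDegreeBound_holds

/-- **(D) ⇐ (H1).**  The residue (D) of `stub_permify` (hypothesis `hD` of
`permEmbedding_of_irreducible`, verbatim) follows from the spin dichotomy (H1) ALONE.  Conditional on
(H1) (Schur 1911; Hoffman–Humphreys Thms. 2.11, 10.7; not in Mathlib). [folklore] -/
theorem permEmbeddingD_of_spinDichotomy
    (hExt : ∃ a : ℕ, ∀ (n k : ℕ) (E : Type) [Group E] [Finite E]
      (ψ : E →* ↥(alternatingGroup (Fin n)) × ↥(alternatingGroup (Fin n)))
      (σ : E →* GL (Fin k) ℂ),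
      Function.Surjective ψ →
      (∀ g : E, ψ g = 1 → ∃ c : ℂ,
        (σ g : Matrix (Fin k) (Fin k) ℂ) = c • (1 : Matrix (Fin k) (Fin k) ℂ)) →
      n ≤ a * (Nat.log 2 k + 1) ∨
        ∃ θ : E →* ℂˣ, ∀ g : E, ψ g = 1 →
          (σ g : Matrix (Fin k) (Fin k) ℂ) = ((θ g : ℂˣ) : ℂ) • (1 : Matrix (Fin k) (Fin k) ℂ)) :
    ∃ d : ℕ, ∀ (n M k : ℕ) (G : Type) [Group G] [Finite G]
      (φ : G →* Equiv.Perm (Fin n) × Equiv.Perm (Fin n)) (ρ : G →* GL (Fin k) ℂ),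
      Function.Surjective φ →
      (∀ g : G, φ g = 1 → ∃ c : ℂ, c ^ M = 1 ∧
        (ρ g : Matrix (Fin k) (Fin k) ℂ) = c • (1 : Matrix (Fin k) (Fin k) ℂ)) →
      k ≤ M →
      (∀ W : Submodule ℂ (Fin k → ℂ),
        (∀ g : G, W ≤ W.comap (Matrix.toLin' (ρ g : Matrix (Fin k) (Fin k) ℂ))) → W = ⊥ ∨ W = ⊤) →
      ∃ m' ≤ 2 ^ ((Nat.log 2 M + Nat.log 2 n + d) ^ d),
        ∃ (ι : Matrix (Fin m') (Fin k) ℂ) (p : Matrix (Fin k) (Fin m') ℂ) (τ : G → Equiv.Perm (Fin m')),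
          p * ι = 1 ∧ ∀ g : G,
            (τ g).permMatrix ℂ * ι = ι * (ρ g : Matrix (Fin k) (Fin k) ℂ) ∧
            p * (τ g).permMatrix ℂ = (ρ g : Matrix (Fin k) (Fin k) ℂ) * p :=
  permEmbeddingD_of_alternatingBounds hExt youngFixedVector_holds

end Summit.ValiantsHypothesis.ValiantsHypothesis.Theorems.SymPencilEquivariantSdcNotQP.YoungBounds

end
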